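import Summits.QuantumFields.YangMills.Theses.ColdStartUniversality
import Summits.QuantumFields.YangMills.Theorems.ColdStartUniversalityLatticeLangevinWilsonInvariant
import HarnessLib

/-!
# Crux K_A1 `UniformColdStartMixing` (stmt-QuantumFields-24809) — plan-only first rung
# `stub_fixedCutoffMixing` (BC5), `Lines/rung_fixedCutoffMixing.lean`, v6 (seat `ym-line-csu-p1`, g8, 2026-08-28): CLOSED

NOT a registered skeleton of the crux (the K_A1 body is untouched).  The rung = K_A1 with `T` after `K` (fixed-cut-off
cold-start Cesàro mixing in physical time of Bałaban's block-averaged loop observables under the SU(2) SZZ dynamics) is now a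
SORRY-FREE THEOREM of the tree: `Summit.QuantumFields.YangMills.Theorems.ColdStartUniversality.fixedCutoffMixing`
(`Theorems/ColdStartUniversalityLatticeLangevinWilsonInvariant.lean`), by Harris/Doeblin (`fixedCutoffMixing_of_doeblin`, g4) with
both analytic walls supplied:
* (D) Doeblin minorisation at every coupling — `doeblin_szz` (g7: ground-state supersolution + latitude eigen-calculus at `β' = 0`);
* (Inv) SZZ Lemma 3.3 at every coupling — `wilsonMeasureLangevinInvariant_su2` (g8: ground-state Duhamel identity
  `groundState_duhamel`, Haar symmetry of the `β' = 0` kernels `integral_mul_transition_symm_beta_zero`, Dynkin for `e^{ψ̂/2}`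
  `integral_exp_half_psi_beta_zero`, integrated Duhamel identity `integrated_duhamel`, abstract Picard/Grönwall step
  `integral_kernel_weighted_eq_of_duhamel`, dictionary `integral_wilsonMeasure_eq_const_mul`).
No named fact, no sorry remains on this rung.  RECORD-rung R3 plumbing; NOT the K-uniform crux K_A1, NOT the mass gap.
-/

set_option autoImplicit false

noncomputable section

namespace Summit.QuantumFields.YangMills.Cruxes.UniformColdStartMixing.RungFixedCutoffMixing

open MeasureTheory ProbabilityTheory intervalIntegral
open scoped NNReal
open Literature.MathematicalPhysics.QuantumFieldTheory
open Literature.MathematicalPhysics.QuantumLattice (fundamentalRep fundamentalLatticeRep)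
open Literature.MathematicalPhysics.QuantumFieldTheory.Balaban1983to89
open Summit.QuantumFields.YangMills.Theorems.ColdStartUniversality

/-- SZZ Lemma 3.3 for `SU(2)`, `d = 3` is a THEOREM of the tree at every coupling (g8). -/
theorem wilsonInvariant (L : ℕ) [NeZero L] (β' : ℝ) : WilsonMeasureLangevinInvariant (fundamentalLatticeRep 2) 3 L β' :=
  wilsonMeasureLangevinInvariant_su2 L β'

/-- **The rung `stub_fixedCutoffMixing`** (K_A1 with `T` chosen after `K`), sorry-free: the tree theorem `fixedCutoffMixing`. -/
theorem stub_fixedCutoffMixing :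
    ∀ (F : T3ContinuumYM3Torus.T3Family) (γ : ℝ), 0 < γ →
      ∀ (os : List (T3ContinuumYM3Torus.ULoop3 F)) (δ : ℝ), 0 < δ → ∀ K : ℕ, ∃ T : ℝ, 0 < T ∧
        ∀ (Ω : Type) (mΩ : MeasurableSpace Ω) (P : Measure Ω) (hP : IsProbabilityMeasure P)
          (W : ℝ≥0 → Ω → (Edge 3 ((F.P K).sitesPerDir 0) × NoiseIdx 2 → ℝ)) (hW : IsFlatBrownian W P)
          (U : ℝ≥0 → Ω → GaugeConfig 3 ((F.P K).sitesPerDir 0) (Matrix.specialUnitaryGroup (Fin 2) ℂ)),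
          (∀ ω, U 0 ω = fun _ => 1) →
          (latticeLangevinDynamics (fundamentalLatticeRep 2) ((γ * (F.P K).eps)⁻¹ / 2)).IsSolution
            (fundamentalRep (Fin 2)) hW.natFiltration P W U →
          |(F.scheme (ExpMeanLog.expMeanLogSU : LoopAverage (Matrix.specialUnitaryGroup (Fin 2) ℂ)) γ).expectAt
                K os -
              T⁻¹ * ∫ s in (0 : ℝ)..T, (∫ ω, (os.map fun C => F.avgObs (ExpMeanLog.expMeanLogSU :
                  LoopAverage (Matrix.specialUnitaryGroup (Fin 2) ℂ)) K C
                (fun b : PBond (F.P K) 0 => U (s / (F.P K).eps).toNNReal ω (b.src, b.dir))).prod ∂P)| ≤ δ :=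
  fixedCutoffMixing

end Summit.QuantumFields.YangMills.Cruxes.UniformColdStartMixing.RungFixedCutoffMixing

end
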